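import Literature.Barriers.Parity.SiegelZeroPrimePairsProofs
import Literature.Barriers.Parity.SiegelZeroPrimePairsDyadicSmoothing
import HarnessLib

/-!
# Matomäki–Merikoski Theorem 1.3 ⟹ the Hardy–Littlewood pair asymptotic uniformly for shifts
# below the exceptional modulus (barrier-audit sharpening of the scope of
# `Literature.Barriers.Parity.SiegelZeroPrimePairBarrier`)

Sibling of `Literature/Barriers/Parity/SiegelZeroPrimePairsProofs.lean` (the printed deduction of
Corollary 1.1(ii) from Theorem 1.3 for a FIXED shift `h`). The catalogue entry
`Literature.Barriers.Parity.SiegelZeroPrimePairBarrier` records that only SHIFT-UNIFORM prime-pair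
bounds are obstructed by the exceptional character, "in effect `k ≡ 0 (mod q)`". This file makes
that remark quantitative and kernel-checked: the correction factor
`1_{φ(2^r) ∣ h} (−1)^{h/φ(2^r)} ∏_{p ∣ q', p ∤ h} (−1)/(p − 2)` of Theorem 1.3 has modulus
`∏_{p ∣ q', p ∤ h} (p − 2)⁻¹ ≤ √(24h/q)` for a primitive quadratic character mod `q = 2^r q'`
(`Literature.Barriers.Parity.SiegelCorr.abs_corr_le`, proved in the sibling file), so it is
negligible for every shift `h` that is small compared with the exceptional modulus `q`:

* `MatomakiMerikoski2023_uniformShift_of_pairCorrelation` — Theorem 1.3 ⟹ uniformly for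
  `1 ≤ h ≤ A·X`, `X = q^V`, `V ≥ 10 log η`:
  `|∑_{n ≤ X} Λ(n)Λ(n+h) − X𝔖_h| ≤ K_A (h/φ(h)) X (log⁶η/(η/V)) + 6√(24h/q) (h/φ(h)) X`
  (**proved**; the first term is the printed Corollary 1.1(ii) error with its `h`-dependence
  made explicit as `h/φ(h)`, the second is the whole price of uniformity).
* `MatomakiMerikoski2023_smallShift_of_pairCorrelation` — Theorem 1.3 ⟹ for every `δ > 0`,
  uniformly for `1 ≤ h ≤ min(A·X, q^{1−δ})`:
  `|∑_{n ≤ X} Λ(n)Λ(n+h) − X𝔖_h| ≤ K_{A,δ} (h/φ(h)) X log⁶η/(η/V)` (**proved**; Siegel's theorem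
  `Literature.NumberTheory.LFunctions.Siegel.exists_one_sub_realZero_ge` with exponent `δ/2` turns
  `q^{−δ/2}` into `≤ 1/(C(δ/2) η log 2)`).

Consequence for the scope of the barrier: in the illusory world of Theorem 1.3 the
Hardy–Littlewood asymptotic holds uniformly over all shifts below the modulus scale `q^{1−δ}`;
the obstruction to shift-uniform bounds is carried entirely by shifts commensurable with the odd
part `q'` of the exceptional modulus (`h ≥ q/24` is necessary for `|corr| ≥ 1`).

## References

* K. Matomäki, J. Merikoski, *Siegel zeros, twin primes, Goldbach's conjecture, and primes in
  short intervals*, IMRN 2023:23, 20337–20384 (arXiv:2112.11412): Theorem 1.3, Corollary 1.1 and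
  the deduction printed after Theorem 1.4; remark after Theorem 1.3 ("the main term vanishes for
  some even `h`, for instance when `3 ∣ q` and `h = 2q/3`").
  [cite: MatomakiMerikoski2023, Theorem 1.3]
* H. L. Montgomery, R. C. Vaughan, *Multiplicative Number Theory I*, Cambridge 2007, Cor. 11.15.
  [cite: MontgomeryVaughan2007, Corollary 11.15]
-/

noncomputable section

open Finset Real
open scoped ArithmeticFunction.vonMangoldt

namespace Literature.Barriers.Parity

/-- **Theorem 1.3 ⟹ Hardy–Littlewood uniformly in the shift, with the explicit price `√(24h/q)`.**
For every `A > 0` there is `K > 0` such that for every primitive quadratic `χ` mod `q ≥ 2` with a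
real zero `β₀ = 1 − 1/(η log q)`, `η ≥ 10`, every `X = q^V` with `V ≥ 10 log η` and every shift
`1 ≤ h ≤ A X`:
`|∑_{n ≤ X} Λ(n)Λ(n + h) − X𝔖_h| ≤ K (h/φ(h)) X log⁶η/(η/V) + 6 √(24h/q) (h/φ(h)) X`.
The three error terms of Theorem 1.3 (`C = 1`, `ε = 1/10`) are each `≪ V log⁶η/η` for
`V ≥ 10 log η` exactly as in the printed deduction of Corollary 1.1(ii) (Siegel's theorem with
exponent `1/4` handles `exp(−√log X)`), and the correction factor costs
`X 𝔖_h |corr| ≤ X · 6(h/φ(h)) · √(24h/q)` (`SiegelCorr.abs_corr_le`,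
`MMSmoothing.goldbachSingularSeries_le_mul_div_totient`).
[cite: MatomakiMerikoski2023, Theorem 1.3 and the deduction after Theorem 1.4] -/
theorem MatomakiMerikoski2023_uniformShift_of_pairCorrelation
    (h13 : MatomakiMerikoski2023_pairCorrelation) :
    ∀ A : ℝ, 0 < A → ∃ K : ℝ, 0 < K ∧
      ∀ (q : ℕ) [NeZero q], 2 ≤ q → ∀ χ : DirichletCharacter ℂ q, χ.IsPrimitive → χ.IsQuadratic →
        ∀ η : ℝ, 10 ≤ η → χ.LFunction ((1 - 1 / (η * Real.log q) : ℝ) : ℂ) = 0 →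
          ∀ V X : ℝ, 10 * Real.log η ≤ V → X = (q : ℝ) ^ V → ∀ h : ℕ, 1 ≤ h → (h : ℝ) ≤ A * X →
            |(∑ n ∈ Icc 1 ⌊X⌋₊, Λ n * Λ (n + h)) -
                X * Literature.NumberTheory.Sieve.goldbachSingularSeries h| ≤
              K * ((h : ℝ) / (Nat.totient h : ℝ)) * X * (Real.log η ^ (6 : ℕ) / (η / V)) +
                6 * Real.sqrt (24 * h / q) * ((h : ℝ) / (Nat.totient h : ℝ)) * X := by
  intro A hA
  -- Siegel's theorem (MV Cor. 11.15) with exponent `1/4`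
  obtain ⟨CS, hCS, hSiegel⟩ :=
    Literature.NumberTheory.LFunctions.Siegel.exists_one_sub_realZero_ge (ε := 1 / 4) (by norm_num)
  have hlog2 : 0 < Real.log 2 := Real.log_pos one_lt_two
  set D : ℝ := 1 / (CS * Real.log 2) with hDdef
  have hD : 0 < D := by positivity
  -- Theorem 1.3 with `C = 1`, `ε = 1/10`, `A`
  obtain ⟨K₁, hK₁, h13'⟩ := h13 1 le_rfl (1 / 10) (by norm_num) A hA
  refine ⟨K₁ * (3 + D ^ 2), by positivity, ?_⟩
  intro q _ hq χ hprim hquad η hη hzero V X hVlo hX h hh hhX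
  -- basic positivity
  have hq2 : (2 : ℝ) ≤ q := by exact_mod_cast hq
  have hq1 : (1 : ℝ) ≤ q := by linarith
  have hq0 : (0 : ℝ) < q := by linarith
  have hlogq : Real.log 2 ≤ Real.log q := Real.log_le_log two_pos hq2
  have hlogq0 : 0 < Real.log q := lt_of_lt_of_le hlog2 hlogq
  have hη0 : (0 : ℝ) < η := by linarith
  have hη1 : (1 : ℝ) ≤ η := by linarith
  set L : ℝ := Real.log η with hLdef
  have hL1 : 1 ≤ L := by
    rw [hLdef, Real.le_log_iff_exp_le hη0]
    linarith [Real.exp_one_lt_three]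
  have hL0 : 0 < L := by linarith
  have hV10 : 10 ≤ V := by
    have : (10 : ℝ) * 1 ≤ 10 * L := mul_le_mul_of_nonneg_left hL1 (by norm_num)
    linarith
  have hV0 : 0 < V := by linarith
  have hLV : L ≤ V := by linarith
  have hX1 : 1 ≤ X := by rw [hX]; exact Real.one_le_rpow hq1 hV0.le
  have hX0 : 0 < X := by linarith
  have hlogX : Real.log X = V * Real.log q := by rw [hX, Real.log_rpow hq0]
  have hh0 : (0 : ℝ) < h := by exact_mod_cast hh
  have htot : (0 : ℝ) < (Nat.totient h : ℝ) := by exact_mod_cast Nat.totient_pos.mpr hh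
  have hquot : 0 < (h : ℝ) / (Nat.totient h : ℝ) := by positivity
  -- `χ ≠ 1`
  have hne : χ ≠ 1 := by
    intro h1
    have := (DirichletCharacter.eq_one_iff_conductor_eq_one (χ := χ)).mp h1
    rw [hprim] at this
    omega
  -- Siegel: `η ≤ D q^{1/4}`
  have hηD : η ≤ D * (q : ℝ) ^ (1 / 4 : ℝ) := by
    have hS := hSiegel q χ hquad.sq_eq_one hne (1 - 1 / (η * Real.log q)) hzero
    have hS' : CS * (q : ℝ) ^ (-(1 / 4 : ℝ)) ≤ 1 / (η * Real.log q) := by linarith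
    have hpos : 0 < CS * (q : ℝ) ^ (-(1 / 4 : ℝ)) := by positivity
    have hηlog : η * Real.log q ≤ (q : ℝ) ^ (1 / 4 : ℝ) / CS := by
      have := (le_one_div hpos (by positivity)).mp hS'
      calc η * Real.log q ≤ 1 / (CS * (q : ℝ) ^ (-(1 / 4 : ℝ))) := this
        _ = (q : ℝ) ^ (1 / 4 : ℝ) / CS := by
            rw [Real.rpow_neg hq0.le]; field_simp
    calc η = η * Real.log q / Real.log q := by field_simp
      _ ≤ ((q : ℝ) ^ (1 / 4 : ℝ) / CS) / Real.log q := by gcongr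
      _ ≤ ((q : ℝ) ^ (1 / 4 : ℝ) / CS) / Real.log 2 := by gcongr
      _ = D * (q : ℝ) ^ (1 / 4 : ℝ) := by rw [hDdef]; field_simp
  -- the target error `T = log⁶η / (η/V)` dominates `1/η`
  set T : ℝ := L ^ 6 / (η / V) with hTdef
  have hT' : T = V * L ^ 6 / η := by rw [hTdef, div_div_eq_mul_div]; ring
  have hTη : 1 / η ≤ T := by
    rw [hT']
    refine div_le_div_of_nonneg_right ?_ hη0.le
    have hL6 : 1 ≤ L ^ 6 := one_le_pow₀ hL1
    exact one_le_mul_of_one_le_of_one_le (by linarith) hL6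
  have hT0 : 0 < T := lt_of_lt_of_le (by positivity) hTη
  -- E1 = exp(−√(V log η)) ≤ 1/η
  have hE1 : Real.exp (-1 * Real.sqrt (V * L)) ≤ 1 / η := by
    rw [neg_one_mul, Real.exp_neg, one_div, inv_le_inv₀ (Real.exp_pos _) hη0]
    calc η = Real.exp L := (Real.exp_log hη0).symm
      _ ≤ Real.exp (Real.sqrt (V * L)) := Real.exp_le_exp.mpr ?_
    calc L = Real.sqrt (L ^ 2) := (Real.sqrt_sq hL0.le).symm
      _ ≤ Real.sqrt (V * L) :=
          Real.sqrt_le_sqrt (by rw [pow_two]; exact mul_le_mul_of_nonneg_right hLV hL0.le)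
  -- E2 = exp(−(log X)^{1/2}) ≤ (1 + D²)/η
  have hE2 : Real.exp (-1 * Real.log X ^ (3 / 5 - 1 / 10 : ℝ)) ≤ (1 + D ^ 2) / η := by
    have hexp : (3 / 5 - 1 / 10 : ℝ) = 1 / 2 := by norm_num
    rw [hexp, ← Real.sqrt_eq_rpow, neg_one_mul, hlogX]
    rcases le_or_gt η q with hle | hlt
    · have hlq : L ≤ Real.log q := Real.log_le_log hη0 hle
      have h1 : Real.exp (-Real.sqrt (V * Real.log q)) ≤ 1 / η := by
        rw [Real.exp_neg, one_div, inv_le_inv₀ (Real.exp_pos _) hη0]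
        calc η = Real.exp L := (Real.exp_log hη0).symm
          _ ≤ Real.exp (Real.sqrt (V * Real.log q)) := Real.exp_le_exp.mpr ?_
        calc L = Real.sqrt (L ^ 2) := (Real.sqrt_sq hL0.le).symm
          _ ≤ Real.sqrt (V * Real.log q) :=
              Real.sqrt_le_sqrt (by rw [pow_two]; exact mul_le_mul hLV hlq hL0.le hV0.le)
      calc Real.exp (-Real.sqrt (V * Real.log q)) ≤ 1 / η := h1
        _ ≤ (1 + D ^ 2) / η :=
            div_le_div_of_nonneg_right (le_add_of_nonneg_right (sq_nonneg D)) hη0.le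
    · -- `q < η`: then `η ≤ D q^{1/4} ≤ D √q ≤ D √η`, so `η ≤ D²`
      have hchain : η ≤ D * Real.sqrt η := by
        calc η ≤ D * (q : ℝ) ^ (1 / 4 : ℝ) := hηD
          _ ≤ D * (q : ℝ) ^ (1 / 2 : ℝ) :=
              mul_le_mul_of_nonneg_left
                (Real.rpow_le_rpow_of_exponent_le hq1 (by norm_num : (1 / 4 : ℝ) ≤ 1 / 2)) hD.le
          _ = D * Real.sqrt q := by rw [Real.sqrt_eq_rpow]
          _ ≤ D * Real.sqrt η := by gcongr
      have hs0 : 0 < Real.sqrt η := Real.sqrt_pos.mpr hη0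
      have hsD : Real.sqrt η ≤ D := by
        calc Real.sqrt η = η / Real.sqrt η := Real.div_sqrt.symm
          _ ≤ D * Real.sqrt η / Real.sqrt η := by gcongr
          _ = D := by field_simp
      have hηD2 : η ≤ D ^ 2 := by
        calc η = Real.sqrt η ^ 2 := (Real.sq_sqrt hη0.le).symm
          _ ≤ D ^ 2 := pow_le_pow_left₀ hs0.le hsD 2
      have h1 : Real.exp (-Real.sqrt (V * Real.log q)) ≤ 1 := by
        rw [Real.exp_le_one_iff]
        linarith [Real.sqrt_nonneg (V * Real.log q)]
      calc Real.exp (-Real.sqrt (V * Real.log q)) ≤ 1 := h1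
        _ ≤ (1 + D ^ 2) / η := by rw [le_div_iff₀ hη0]; linarith
  -- the correction factor and the singular series
  have hcorr := SiegelCorr.abs_corr_le (R := ℂ) χ hprim hquad hh
  set G : ℝ := Literature.NumberTheory.Sieve.goldbachSingularSeries h with hGdef
  have hG0 : 0 ≤ G :=
    Literature.NumberTheory.Sieve.SingularSeriesMean.goldbachSingularSeries_nonneg h
  have hG6 : G ≤ 6 * ((h : ℝ) / (Nat.totient h : ℝ)) :=
    MMSmoothing.goldbachSingularSeries_le_mul_div_totient (h := h) (by omega)
  -- Theorem 1.3
  have hmain := h13' q hq χ hprim hquad η hη hzero V X hV10 hX h hh hhX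
  -- assemble
  set S : ℝ := ∑ n ∈ Icc 1 ⌊X⌋₊, Λ n * Λ (n + h) with hSdef
  set corr : ℝ := (if Nat.totient (2 ^ padicValNat 2 q) ∣ h then
        (-1 : ℝ) ^ (h / Nat.totient (2 ^ padicValNat 2 q)) *
          ∏ p ∈ (q / 2 ^ padicValNat 2 q).primeFactors.filter (fun p => ¬ p ∣ h),
            (-1 : ℝ) / ((p : ℝ) - 2)
      else 0) with hcorrdef
  have htri : |S - X * G| ≤ |S - X * G * (1 + corr)| + |X * G * (1 + corr) - X * G| :=
    abs_sub_le _ _ _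
  have hmid : |X * G * (1 + corr) - X * G| = X * G * |corr| := by
    rw [show X * G * (1 + corr) - X * G = X * G * corr by ring, abs_mul, abs_mul, abs_of_pos hX0,
      abs_of_nonneg hG0]
  have hsum : Real.exp (-1 * Real.sqrt (V * L)) + Real.exp (-1 * Real.log X ^ (3 / 5 - 1 / 10 : ℝ))
      + V * L ^ 6 / η ≤ (3 + D ^ 2) * T := by
    have hE2' : (1 + D ^ 2) / η ≤ (1 + D ^ 2) * T := by
      rw [div_eq_mul_one_div]
      exact mul_le_mul_of_nonneg_left hTη (by positivity)
    rw [← hT']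
    linarith
  have hc0 : 0 ≤ K₁ * ((h : ℝ) / (Nat.totient h : ℝ)) * X := by positivity
  have hsecond : X * G * |corr| ≤ 6 * Real.sqrt (24 * h / q) * ((h : ℝ) / (Nat.totient h : ℝ)) * X := by
    calc X * G * |corr| ≤ X * (6 * ((h : ℝ) / (Nat.totient h : ℝ))) * Real.sqrt (24 * h / q) := by
          gcongr
      _ = 6 * Real.sqrt (24 * h / q) * ((h : ℝ) / (Nat.totient h : ℝ)) * X := by ring
  calc |S - X * G| ≤ |S - X * G * (1 + corr)| + |X * G * (1 + corr) - X * G| := htri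
    _ ≤ K₁ * ((h : ℝ) / (Nat.totient h : ℝ)) * X *
          (Real.exp (-1 * Real.sqrt (V * L)) + Real.exp (-1 * Real.log X ^ (3 / 5 - 1 / 10 : ℝ))
            + V * L ^ 6 / η) + X * G * |corr| := by
        rw [hmid]; exact add_le_add hmain le_rfl
    _ ≤ K₁ * ((h : ℝ) / (Nat.totient h : ℝ)) * X * ((3 + D ^ 2) * T) +
          6 * Real.sqrt (24 * h / q) * ((h : ℝ) / (Nat.totient h : ℝ)) * X := by
        gcongr
    _ = K₁ * (3 + D ^ 2) * ((h : ℝ) / (Nat.totient h : ℝ)) * X * T +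
          6 * Real.sqrt (24 * h / q) * ((h : ℝ) / (Nat.totient h : ℝ)) * X := by ring
    _ = _ := by rw [hTdef]

/-- **Theorem 1.3 ⟹ Hardy–Littlewood uniformly for all shifts `h ≤ q^{1−δ}` below the exceptional
modulus.** For every `δ > 0` and `A > 0` there is `K > 0` such that for every primitive quadratic
`χ` mod `q ≥ 2` with a real zero `β₀ = 1 − 1/(η log q)`, `η ≥ 10`, every `X = q^V` with
`V ≥ 10 log η` and every shift `1 ≤ h ≤ A X` with `h ≤ q^{1−δ}`:
`|∑_{n ≤ X} Λ(n)Λ(n + h) − X𝔖_h| ≤ K (h/φ(h)) X log⁶η/(η/V)` — the error of Corollary 1.1(ii),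
now uniform in `h`. From `MatomakiMerikoski2023_uniformShift_of_pairCorrelation`:
`√(24h/q) ≤ √24 · q^{−δ/2}` and, by Siegel's theorem with exponent `δ/2`
(`Literature.NumberTheory.LFunctions.Siegel.exists_one_sub_realZero_ge`),
`C(δ/2) q^{−δ/2} ≤ 1 − β₀ = 1/(η log q)`, so `q^{−δ/2} ≤ 1/(C(δ/2) log 2 · η) ≤ V log⁶η/(C(δ/2) log 2 · η)`.
Scope consequence for `SiegelZeroPrimePairBarrier`: the illusory-world obstruction to
shift-uniform pair asymptotics is carried only by shifts `h > q^{1−δ}` commensurable with the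
exceptional modulus. [cite: MatomakiMerikoski2023, Theorem 1.3 and Corollary 1.1(ii)] -/
theorem MatomakiMerikoski2023_smallShift_of_pairCorrelation
    (h13 : MatomakiMerikoski2023_pairCorrelation) :
    ∀ δ : ℝ, 0 < δ → ∀ A : ℝ, 0 < A → ∃ K : ℝ, 0 < K ∧
      ∀ (q : ℕ) [NeZero q], 2 ≤ q → ∀ χ : DirichletCharacter ℂ q, χ.IsPrimitive → χ.IsQuadratic →
        ∀ η : ℝ, 10 ≤ η → χ.LFunction ((1 - 1 / (η * Real.log q) : ℝ) : ℂ) = 0 →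
          ∀ V X : ℝ, 10 * Real.log η ≤ V → X = (q : ℝ) ^ V → ∀ h : ℕ, 1 ≤ h → (h : ℝ) ≤ A * X →
            (h : ℝ) ≤ (q : ℝ) ^ (1 - δ) →
            |(∑ n ∈ Icc 1 ⌊X⌋₊, Λ n * Λ (n + h)) -
                X * Literature.NumberTheory.Sieve.goldbachSingularSeries h| ≤
              K * ((h : ℝ) / (Nat.totient h : ℝ)) * X * (Real.log η ^ (6 : ℕ) / (η / V)) := by
  intro δ hδ A hA
  obtain ⟨K₁, hK₁, hU⟩ := MatomakiMerikoski2023_uniformShift_of_pairCorrelation h13 A hA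
  -- Siegel's theorem (MV Cor. 11.15) with exponent `δ/2`
  obtain ⟨C₂, hC₂, hSiegel⟩ :=
    Literature.NumberTheory.LFunctions.Siegel.exists_one_sub_realZero_ge (ε := δ / 2) (half_pos hδ)
  have hlog2 : 0 < Real.log 2 := Real.log_pos one_lt_two
  set D₂ : ℝ := 1 / (C₂ * Real.log 2) with hD₂def
  have hD₂ : 0 < D₂ := by positivity
  refine ⟨K₁ + 6 * Real.sqrt 24 * D₂, by positivity, ?_⟩
  intro q _ hq χ hprim hquad η hη hzero V X hVlo hX h hh hhX hhq
  have hmain := hU q hq χ hprim hquad η hη hzero V X hVlo hX h hh hhX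
  -- basic positivity
  have hq2 : (2 : ℝ) ≤ q := by exact_mod_cast hq
  have hq0 : (0 : ℝ) < q := by linarith
  have hlogq : Real.log 2 ≤ Real.log q := Real.log_le_log two_pos hq2
  have hlogq0 : 0 < Real.log q := lt_of_lt_of_le hlog2 hlogq
  have hη0 : (0 : ℝ) < η := by linarith
  have hL1 : 1 ≤ Real.log η := by
    rw [Real.le_log_iff_exp_le hη0]
    linarith [Real.exp_one_lt_three]
  have hV1 : 1 ≤ V := by linarith
  have hV0 : 0 < V := by linarith
  have hX0 : 0 < X := by rw [hX]; exact Real.rpow_pos_of_pos hq0 V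
  have hh0 : (0 : ℝ) < h := by exact_mod_cast hh
  have htot : (0 : ℝ) < (Nat.totient h : ℝ) := by exact_mod_cast Nat.totient_pos.mpr hh
  have hquot : 0 < (h : ℝ) / (Nat.totient h : ℝ) := by positivity
  -- `χ ≠ 1`
  have hne : χ ≠ 1 := by
    intro h1
    have := (DirichletCharacter.eq_one_iff_conductor_eq_one (χ := χ)).mp h1
    rw [hprim] at this
    omega
  -- Siegel: `q^{-δ/2} ≤ D₂ / η`
  have hqδ : (q : ℝ) ^ (-(δ / 2)) ≤ D₂ / η := by
    have hS := hSiegel q χ hquad.sq_eq_one hne (1 - 1 / (η * Real.log q)) hzero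
    have hS' : C₂ * (q : ℝ) ^ (-(δ / 2)) ≤ 1 / (η * Real.log q) := by linarith
    have h1 : (q : ℝ) ^ (-(δ / 2)) ≤ 1 / (η * Real.log q) / C₂ := by
      rw [le_div_iff₀ hC₂]; linarith
    calc (q : ℝ) ^ (-(δ / 2)) ≤ 1 / (η * Real.log q) / C₂ := h1
      _ ≤ 1 / (η * Real.log 2) / C₂ := by gcongr
      _ = D₂ / η := by rw [hD₂def]; field_simp
  -- `√(24 h / q) ≤ √24 · q^{-δ/2}`
  have hsqrt : Real.sqrt (24 * h / q) ≤ Real.sqrt 24 * (q : ℝ) ^ (-(δ / 2)) := by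
    have hhq' : (h : ℝ) / q ≤ (q : ℝ) ^ (-δ) := by
      rw [div_le_iff₀ hq0]
      calc (h : ℝ) ≤ (q : ℝ) ^ (1 - δ) := hhq
        _ = (q : ℝ) ^ (-δ) * q := by
            rw [show (1 - δ : ℝ) = -δ + 1 by ring, Real.rpow_add hq0, Real.rpow_one]
    have hpow : Real.sqrt ((q : ℝ) ^ (-δ)) = (q : ℝ) ^ (-(δ / 2)) := by
      rw [Real.sqrt_eq_rpow, ← Real.rpow_mul hq0.le]; ring_nf
    calc Real.sqrt (24 * h / q) = Real.sqrt (24 * ((h : ℝ) / q)) := by rw [mul_div_assoc]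
      _ = Real.sqrt 24 * Real.sqrt ((h : ℝ) / q) := Real.sqrt_mul (by norm_num) _
      _ ≤ Real.sqrt 24 * Real.sqrt ((q : ℝ) ^ (-δ)) := by gcongr
      _ = Real.sqrt 24 * (q : ℝ) ^ (-(δ / 2)) := by rw [hpow]
  -- `1/η ≤ log⁶η/(η/V)`
  have hTη : 1 / η ≤ Real.log η ^ (6 : ℕ) / (η / V) := by
    rw [div_div_eq_mul_div, div_le_div_iff_of_pos_right hη0]
    have hL6 : 1 ≤ Real.log η ^ 6 := one_le_pow₀ hL1
    exact one_le_mul_of_one_le_of_one_le hL6 hV1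
  have hsecond : 6 * Real.sqrt (24 * h / q) * ((h : ℝ) / (Nat.totient h : ℝ)) * X ≤
      6 * Real.sqrt 24 * D₂ * ((h : ℝ) / (Nat.totient h : ℝ)) * X *
        (Real.log η ^ (6 : ℕ) / (η / V)) := by
    have h1 : Real.sqrt (24 * h / q) ≤ Real.sqrt 24 * D₂ * (Real.log η ^ (6 : ℕ) / (η / V)) := by
      calc Real.sqrt (24 * h / q) ≤ Real.sqrt 24 * (q : ℝ) ^ (-(δ / 2)) := hsqrt
        _ ≤ Real.sqrt 24 * (D₂ / η) := by gcongr
        _ = Real.sqrt 24 * D₂ * (1 / η) := by ring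
        _ ≤ Real.sqrt 24 * D₂ * (Real.log η ^ (6 : ℕ) / (η / V)) := by gcongr
    calc 6 * Real.sqrt (24 * h / q) * ((h : ℝ) / (Nat.totient h : ℝ)) * X
        = (6 * ((h : ℝ) / (Nat.totient h : ℝ)) * X) * Real.sqrt (24 * h / q) := by ring
      _ ≤ (6 * ((h : ℝ) / (Nat.totient h : ℝ)) * X) *
            (Real.sqrt 24 * D₂ * (Real.log η ^ (6 : ℕ) / (η / V))) := by gcongr
      _ = _ := by ring
  calc |(∑ n ∈ Icc 1 ⌊X⌋₊, Λ n * Λ (n + h)) -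
          X * Literature.NumberTheory.Sieve.goldbachSingularSeries h|
      ≤ K₁ * ((h : ℝ) / (Nat.totient h : ℝ)) * X * (Real.log η ^ (6 : ℕ) / (η / V)) +
          6 * Real.sqrt (24 * h / q) * ((h : ℝ) / (Nat.totient h : ℝ)) * X := hmain
    _ ≤ K₁ * ((h : ℝ) / (Nat.totient h : ℝ)) * X * (Real.log η ^ (6 : ℕ) / (η / V)) +
          6 * Real.sqrt 24 * D₂ * ((h : ℝ) / (Nat.totient h : ℝ)) * X *
            (Real.log η ^ (6 : ℕ) / (η / V)) := by gcongr
    _ = (K₁ + 6 * Real.sqrt 24 * D₂) * ((h : ℝ) / (Nat.totient h : ℝ)) * X *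
          (Real.log η ^ (6 : ℕ) / (η / V)) := by ring

end Literature.Barriers.Parity

end
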